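import Literature.IUT.HodgeTheaters.GaloisValDatumCoveringMonoidDivisor
import Literature.IUT.HodgeArakelov.GMonoidFrobenioidsEquivariant
import Literature.AlgebraicGeometry.Frobenioids.ModelFrobenioidMap
import HarnessLib

/-!
# B16 closer, rational-function half and the comparison functor: from abc-iut-w4-d019's [IUTchII] Def. 3.8 model
# Frobenioid of the GENUINE `C⊢_v` covering monoid `𝒪^×_{K̄_v}·q̲^ℕ` to the GENUINE `C⊢_v` of [IUTchI] Ex. 3.2 (iv)
# (abc-iut-L1-t4's monogenic [FrdII] datum `GaloisValDatum.dashDatum`), over the identity of `B(K_v)⁰`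

Mochizuki, *Inter-universal Teichmüller Theory I*, kurims manuscript (May 2020), Ex. 3.2 (iv) p. 71: «`Φ_{C⊢_v} :=
ℕ·log_Φ(q̲_v)|_{D⊢_v}` … determines a `p_v`-adic Frobenioid with base category given by `D⊢_v`» [cite: Mochizuki2012, I Ex 3.2
(iv) p.71]; *… II*, Def. 3.8 (i)(ii) p. 113, fragments «gives rise to a `p_v`-adic Frobenioid» and «may be interpreted as an isomorphism of
Frobenioids» [cite: Mochizuki2012, II Def 3.8 (ii) p.113] (D-0012 claim key, status disputed; nothing of the series is
asserted); [FrdII] Ex. 1.1 (ii) p. 8 («`B := B₀|_D ×_{Φ₀^gp|_D} Φ^gp → Φ^gp`») [cite: MochizukiFrdII2008, Ex 1.1 (ii) p.8];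
[FrdI] Thm. 5.2 (i) p. 100, Prop. 5.3 p. 103 («the functors that arise naturally from the construction»)
[cite: MochizukiFrdI2008, Prop. 5.3 p.103].

Cell abc-iut, seat abc-iut-L5-t2 (gen 7); row «B16-i» (δ2-β), part 1 (abc-iut-L6-t7 MERGE-MAP §B16).  DEF-BEARING (6
`MonoidHom` defs incl. `betaApp`, 1 element def `unitPart`; 0 instances / notation / `Prop` facts; nothing landed is edited).  Consumed BY NAME: abc-iut-w4-d019's `CoveringMonoid.invariantsFunctor / ratFnFunctor / divB /
frobenioid / pull / coe_pull_eq_act` (p455796) and abc-iut-L6-t7's `divB_of` (p457393), abc-iut-L1's `ModelFrobenioid.DataHom /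
DataHom.functor / MonGp.map / MonGp.map_of / MonGp.hom_ext / divZeroHom_intNonzeroToUnits / intNonzeroToUnits` and the
monogenic datum API `PadicFrd.Monogenic.BSub / mem_BSub_iff / Bc / Φc / gen`, abc-iut-L5-t2's `GaloisValDatum.dashDatum /
relEmb / fieldFunctor / fixedHom_apply_coe / valOn_iff` and p456702 / p457913 / the divisor half `divisorObjEquiv /
divisorFunctorIso / ofO / dashOrd_pull / invariantUnitOfIsUnit` (`GaloisValDatumCoveringMonoidDivisor.lean`).

WHAT THIS FILE CONSTRUCTS / PROVES (`M := d.dashCoveringMonoid q`, `q` NOT a unit of `𝒪^▷_{K_v}`, `X = G/V ∈ B(K_v)⁰`):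
* `toFixedDashInt hq X : M^V →* 𝒪^▷_{Ω^V}` — a `V`-invariant `u·q̲^n` IS a nonzero integer of the field `Ω^V = K_X` of the
  field functor; **`associatesMk_toFixedDashInt`**: its class in `ord(𝒪^▷_{Ω^V})` is `ord(q̲)^n` (the unit part `u` descends
  to a `V`-invariant unit of `𝒪^▷_{Ω^V}` — `unitPart`, by cancellation in `𝒪^▷_{K̄_v}`);
* `pairHom hq X : M^V →* (Ω^V)^× × (ℕ·log_Φ(q̲)(X))^gp`, `u·q̲^n ↦ (u·q̲^n, log_Φ(q̲)^n)`, LANDS IN abc-iut-L1-t4's fibre product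
  `B^c(X) = B₀ ×_{Φ₀^gp} (Φ^c)^gp` (**`pairHom_mem_BSub`**: `Div₀(u·q̲^n) = ι^gp(log_Φ(q̲)^n)` via `divZeroHom_intNonzeroToUnits`);
* **`betaApp hq X : (M^V)^gp →* B^c(X)`** — the groupified extension (into the equaliser, which is a subgroup: checked on
  generators with `MonGp.hom_ext`); `betaApp_of`;
* generator-level NATURALITY of the `B₀`-coordinate: `bZeroHom_pull` (`pull f` = action of a representative `g` = the field
  functor's `x ↦ g·x`); the divisor coordinate's naturality is `dashOrd_pull` / `divisorObjEquiv_pull` of the divisor half.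
NOT DONE HERE (part 2, named follow-up): packaging `betaApp` as a natural transformation `M.ratFnFunctor ⟶ (d.dashDatum hq).B`,
the `ModelFrobenioid.DataHom` with `η := (divisorFunctorIso hq).hom` (⇒ abc-iut-L1-t2's `DataHom.functor`: the comparison functor
`M.frobenioid ⥤ d.Cdash hq` over the identity of `B(K_v)⁰`), and bijectivity of `betaApp` (⇒ `DataHomOver.functor_isEquivalence`).  HONEST FRAMING: monoid/valuation bookkeeping over the tree's interfaces; nothing asserts a Kummer structure or
takes a side on [IUTchIII] Cor. 3.12; [IUTchI]/[IUTchII] disputed, nothing asserted; typed ≠ proved for anything else.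
-/

noncomputable section

open scoped Classical

namespace Literature.IUT.HodgeTheaters

open CategoryTheory Opposite Function Literature.AnabelianGeometry.SemiGraphs Literature.AlgebraicGeometry.Frobenioids
  Literature.AlgebraicGeometry.Frobenioids.PadicFrd Literature.IUT.HodgeArakelov

universe u

namespace GaloisValDatum

variable {p : ℕ} [Fact p.Prime] (d : GaloisValDatum.{u} p) {q : intNonzero d.k}

/-! ### `V`-invariant elements of `𝒪^×·q̲^ℕ` as nonzero integers of the fixed field `Ω^V` -/

/-- The underlying element of `Ω` of a `V`-invariant element of `M` lies in `Ω^V`. [cite: Mochizuki2012, II Def 4.9 (i) p.154] -/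
theorem val_mem_fixedFld (X : CosetCat d.Gal) (x : (d.dashCoveringMonoid q).invariants (X.sg : Subgroup d.Gal)) :
    (((d.ofO x.1 : d.dashCovering q) : intNonzero d.Ω) : d.Ω) ∈ d.fixedFld X :=
  (IntermediateField.mem_fixedField_iff _ _).mpr fun _ hσ =>
    congrArg (fun z : intNonzero d.Ω => (z : d.Ω)) (d.galAct_coe_eq_of_invariants x hσ)

/-- Valuation transfer `Ω^V ↔ Ω` for the conditions `≤ 1` and `≠ 0` (the field functor's `valOn` is the restriction).
[cite: MochizukiFrdII2008, Ex 1.1 (i) p.7] -/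
theorem mem_intNonzero_fixedFld_iff' (X : CosetCat d.Gal) (y : d.fixedFld X) :
    y ∈ @intNonzero (d.fixedFld X) _ (d.valOn (d.fixedFld X)) ↔ Subtype.val y ∈ intNonzero d.Ω := by
  letI := d.valOn (d.fixedFld X)
  change (ValuativeRel.valuation (d.fixedFld X) y ≤ 1 ∧ y ≠ 0) ↔
    (ValuativeRel.valuation d.Ω (Subtype.val y) ≤ 1 ∧ Subtype.val y ≠ 0)
  rw [← (ValuativeRel.valuation (d.fixedFld X)).map_one, ← Valuation.Compatible.vle_iff_le, d.valOn_iff,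
    OneMemClass.coe_one, Valuation.Compatible.vle_iff_le (v := ValuativeRel.valuation d.Ω), map_one]
  exact and_congr Iff.rfl ⟨fun h h0 => h (Subtype.ext h0), fun h h0 => h (congrArg Subtype.val h0)⟩

/-- Valuation transfer `Ω^V ↔ Ω` for the condition `= 1` (units). [cite: MochizukiFrdII2008, Ex 1.1 (i) p.7] -/
theorem valuation_fixedFld_eq_one_iff (X : CosetCat d.Gal) (y : d.fixedFld X) :
    @ValuativeRel.valuation (d.fixedFld X) _ (d.valOn (d.fixedFld X)) y = 1 ↔
      ValuativeRel.valuation d.Ω (Subtype.val y) = 1 := by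
  letI := d.valOn (d.fixedFld X)
  rw [le_antisymm_iff, le_antisymm_iff, ← (ValuativeRel.valuation (d.fixedFld X)).map_one,
    ← Valuation.Compatible.vle_iff_le, ← Valuation.Compatible.vle_iff_le, d.valOn_iff, d.valOn_iff,
    OneMemClass.coe_one, Valuation.Compatible.vle_iff_le (v := ValuativeRel.valuation d.Ω),
    Valuation.Compatible.vle_iff_le (v := ValuativeRel.valuation d.Ω), map_one]

/-- **`M^V → 𝒪^▷_{Ω^V}`**: a `V`-invariant element `u·q̲^n` of `𝒪^×_{K̄_v}·q̲^ℕ` read as a nonzero integer of the field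
`Ω^V = K_{G/V}` of the field functor. [cite: MochizukiFrdII2008, Ex 1.1 (ii) p.8] -/
def toFixedDashInt (X : CosetCat d.Gal) :
    ↥((d.dashCoveringMonoid q).invariants (X.sg : Subgroup d.Gal)) →* ↥(intNonzero (d.fieldFunctor.obj X).K) where
  toFun x := ⟨⟨_, d.val_mem_fixedFld X x⟩, (d.mem_intNonzero_fixedFld_iff' X _).mpr (d.ofO x.1 : d.dashCovering q).1.2⟩
  map_one' := rfl
  map_mul' _ _ := rfl

/-- Values in `Ω` are unchanged. [cite: MochizukiFrdII2008, Ex 1.1 (ii) p.8] -/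
theorem val_val_toFixedDashInt (X : CosetCat d.Gal) (x : (d.dashCoveringMonoid q).invariants (X.sg : Subgroup d.Gal)) :
    Subtype.val (Subtype.val (d.toFixedDashInt X x)) = (((d.ofO x.1 : d.dashCovering q) : intNonzero d.Ω) : d.Ω) := rfl

/-! ### The unit part descends to `Ω^V` -/

variable (hq : ¬ IsUnit q)

/-- The unit part `u` of a `V`-invariant `x = u·q̲^n` is `V`-invariant (cancellation in `𝒪^▷_{K̄_v}`; `q̲` is `G_v`-fixed).
[cite: Mochizuki2012, II Def 4.9 (i) p.154] -/
theorem galAct_unitPart_eq (X : CosetCat d.Gal) (x : (d.dashCoveringMonoid q).invariants (X.sg : Subgroup d.Gal))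
    {u : intNonzero d.Ω} (hx : ((d.ofO x.1 : d.dashCovering q) : intNonzero d.Ω) = u * d.toΩ q ^ d.dashOrd hq (d.ofO x.1))
    {σ : d.Gal} (hσ : σ ∈ (X.sg : Subgroup d.Gal)) : d.galAct σ u = u := by
  have hxσ := d.galAct_coe_eq_of_invariants x hσ
  rw [hx, map_mul, map_pow, galAct_toΩ] at hxσ
  exact d.intNonzero_mul_right_cancel hxσ

/-- **The unit part `u` of `x = u·q̲^n ∈ M^V` as a nonzero integer of `Ω^V`**. [cite: MochizukiFrdII2008, Ex 1.1 (ii) p.8] -/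
def unitPart (X : CosetCat d.Gal) (x : (d.dashCoveringMonoid q).invariants (X.sg : Subgroup d.Gal))
    {u : intNonzero d.Ω} (hx : ((d.ofO x.1 : d.dashCovering q) : intNonzero d.Ω) = u * d.toΩ q ^ d.dashOrd hq (d.ofO x.1)) :
    ↥(intNonzero (d.fieldFunctor.obj X).K) :=
  ⟨⟨(u : d.Ω), (IntermediateField.mem_fixedField_iff _ _).mpr fun _ hσ =>
      congrArg (fun z : intNonzero d.Ω => (z : d.Ω)) (d.galAct_unitPart_eq hq X x hx hσ)⟩,
    (d.mem_intNonzero_fixedFld_iff' X _).mpr u.2⟩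

/-- The unit part is a UNIT of `𝒪^▷_{Ω^V}` when `u` is a unit of `𝒪^▷_{K̄_v}` (valuation `1` transfers to the fixed field).
[cite: MochizukiFrdII2008, Ex 1.1 (i) p.7] -/
theorem isUnit_unitPart (X : CosetCat d.Gal) (x : (d.dashCoveringMonoid q).invariants (X.sg : Subgroup d.Gal))
    {u : intNonzero d.Ω} (hu : IsUnit u)
    (hx : ((d.ofO x.1 : d.dashCovering q) : intNonzero d.Ω) = u * d.toΩ q ^ d.dashOrd hq (d.ofO x.1)) :
    IsUnit (d.unitPart hq X x hx) := by
  rw [isUnit_intNonzero_iff]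
  exact (d.valuation_fixedFld_eq_one_iff X _).mpr ((isUnit_intNonzero_iff d.Ω u).mp hu)

/-- `x = unitPart · c_X^n` in `𝒪^▷_{Ω^V}` (`c_X = q̲` read in `Ω^V`, abc-iut-L5-t2's `relEmb.img q X`).
[cite: MochizukiFrdII2008, Ex 1.1 (ii) p.8] -/
theorem toFixedDashInt_eq_unitPart_mul (X : CosetCat d.Gal) (x : (d.dashCoveringMonoid q).invariants (X.sg : Subgroup d.Gal))
    {u : intNonzero d.Ω} (hx : ((d.ofO x.1 : d.dashCovering q) : intNonzero d.Ω) = u * d.toΩ q ^ d.dashOrd hq (d.ofO x.1)) :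
    d.toFixedDashInt X x = d.unitPart hq X x hx * d.relEmb.img q X ^ d.dashOrd hq (d.ofO x.1) := by
  apply Subtype.ext
  apply Subtype.ext
  rw [val_val_toFixedDashInt, hx]
  simp only [MulMemClass.coe_mul, SubmonoidClass.coe_pow]
  rfl

/-- **The class of `x = u·q̲^n ∈ M^V` in `ord(𝒪^▷_{Ω^V})` is `ord(q̲)^n`.** [cite: MochizukiFrdII2008, Ex 1.1 (ii) p.8] -/
theorem associatesMk_toFixedDashInt (X : CosetCat d.Gal) (x : (d.dashCoveringMonoid q).invariants (X.sg : Subgroup d.Gal)) :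
    Associates.mk (d.toFixedDashInt X x) = Associates.mk (d.relEmb.img q X) ^ d.dashOrd hq (d.ofO x.1) := by
  obtain ⟨u, hu, hx⟩ := d.dashOrd_spec hq (d.ofO x.1)
  rw [d.toFixedDashInt_eq_unitPart_mul hq X x hx, ← Associates.mk_mul_mk, Associates.mk_pow,
    Associates.mk_eq_one.mpr (d.isUnit_unitPart hq X x hu hx), one_mul]

/-! ### `β` on the monoid: `u·q̲^n ↦ (u·q̲^n, log_Φ(q̲)^n) ∈ B^c(G/V)` -/

/-- The `B₀`-coordinate `M^V →* (Ω^V)^×`. [cite: MochizukiFrdII2008, Ex 1.1 (ii) p.8] -/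
def bZeroHom (X : CosetCat d.Gal) :
    ↥((d.dashCoveringMonoid q).invariants (X.sg : Subgroup d.Gal)) →* ((d.fieldFunctor.obj X).K)ˣ :=
  (intNonzeroToUnits (d.fieldFunctor.obj X).K).comp (d.toFixedDashInt X)

/-- The `(Φ^c)^gp`-coordinate `M^V →* (ℕ·log_Φ(q̲)(X))^gp`, `x ↦ [log_Φ(q̲)^{n}]` (through the divisor half `divisorObjEquiv`).
[cite: MochizukiFrdII2008, Ex 1.1 (ii) p.8] -/
def gpPowHom (X : CosetCat d.Gal) :
    ↥((d.dashCoveringMonoid q).invariants (X.sg : Subgroup d.Gal)) →*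
      Algebra.GrothendieckGroup ↥(Submonoid.powers (Monogenic.gen d.fieldFunctor (d.relEmb.img q) X)) :=
  Algebra.GrothendieckGroup.of.comp (((d.divisorObjEquiv hq X).toMonoidHom).comp (Associates.mkMonoidHom))

/-- Values of `gpPowHom`. [cite: MochizukiFrdII2008, Ex 1.1 (ii) p.8] -/
theorem gpPowHom_apply (X : CosetCat d.Gal) (x : (d.dashCoveringMonoid q).invariants (X.sg : Subgroup d.Gal)) :
    d.gpPowHom hq X x = Algebra.GrothendieckGroup.of (d.divisorObjEquiv hq X (Associates.mk x)) := rfl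

/-- **`pairHom : M^V →* (Ω^V)^× × (ℕ·log_Φ(q̲))^gp`**, `u·q̲^n ↦ (u·q̲^n, log_Φ(q̲)^n)`. [cite: MochizukiFrdII2008, Ex 1.1 (ii) p.8] -/
def pairHom (X : CosetCat d.Gal) :
    ↥((d.dashCoveringMonoid q).invariants (X.sg : Subgroup d.Gal)) →*
      ((d.fieldFunctor.obj X).K)ˣ ×
        Algebra.GrothendieckGroup ↥(Submonoid.powers (Monogenic.gen d.fieldFunctor (d.relEmb.img q) X)) :=
  (d.bZeroHom X).prod (d.gpPowHom hq X)

/-- **`pairHom` lands in the fibre product `B^c(G/V)`**: `Div₀(u·q̲^n) = ι^gp(log_Φ(q̲)^n)` (abc-iut-L1's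
`divZeroHom_intNonzeroToUnits` + `associatesMk_toFixedDashInt`). [cite: MochizukiFrdII2008, Ex 1.1 (ii) p.8] -/
theorem pairHom_mem_BSub (X : CosetCat d.Gal) (x : (d.dashCoveringMonoid q).invariants (X.sg : Subgroup d.Gal)) :
    (show (bZeroOn d.fieldFunctor).obj (op X) ×
        Algebra.GrothendieckGroup ((Monogenic.Φc d.fieldFunctor (d.relEmb.isConstantSection hq)).obj (op X))
      from d.pairHom hq X x) ∈ Monogenic.BSub d.fieldFunctor (d.relEmb.isConstantSection hq) (op X) := by
  refine (Monogenic.mem_BSub_iff _ _ _ _).mpr ?_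
  change divZeroHom (d.fieldFunctor.obj X).K (intNonzeroToUnits (d.fieldFunctor.obj X).K (d.toFixedDashInt X x)) =
    MonGp.map (Submonoid.powers (Monogenic.gen d.fieldFunctor (d.relEmb.img q) X)).subtype
      (Algebra.GrothendieckGroup.of (d.divisorObjEquiv hq X (Associates.mk x)))
  rw [divZeroHom_intNonzeroToUnits, MonGp.map_of, Submonoid.subtype_apply, coe_divisorObjEquiv_mk,
    associatesMk_toFixedDashInt, map_pow]
  rfl

/-- The groupified pair map `(M^V)^gp →* (Ω^V)^× × (ℕ·log_Φ(q̲))^gp`. [cite: MochizukiFrdII2008, Ex 1.1 (ii) p.8] -/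
def liftPair (X : CosetCat d.Gal) :
    Algebra.GrothendieckGroup ↥((d.dashCoveringMonoid q).invariants (X.sg : Subgroup d.Gal)) →*
      ((d.fieldFunctor.obj X).K)ˣ ×
        Algebra.GrothendieckGroup ↥(Submonoid.powers (Monogenic.gen d.fieldFunctor (d.relEmb.img q) X)) :=
  Algebra.GrothendieckGroup.lift (d.pairHom hq X)

/-- `liftPair` on generators. [cite: MochizukiFrdII2008, Ex 1.1 (ii) p.8] -/
theorem liftPair_of (X : CosetCat d.Gal) (x : (d.dashCoveringMonoid q).invariants (X.sg : Subgroup d.Gal)) :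
    d.liftPair hq X (Algebra.GrothendieckGroup.of x) = d.pairHom hq X x := by
  have h := DFunLike.congr_fun (Algebra.GrothendieckGroup.lift.symm_apply_apply (d.pairHom hq X)) x
  rw [Algebra.GrothendieckGroup.lift_symm_apply, MonoidHom.comp_apply] at h
  exact h

/-- `liftPair` lands in the fibre product `B^c(G/V)` (an equaliser of two group homomorphisms: checked on generators).
[cite: MochizukiFrdII2008, Ex 1.1 (ii) p.8] -/
theorem liftPair_mem_BSub (X : CosetCat d.Gal)
    (z : Algebra.GrothendieckGroup ↥((d.dashCoveringMonoid q).invariants (X.sg : Subgroup d.Gal))) :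
    (show (bZeroOn d.fieldFunctor).obj (op X) ×
        Algebra.GrothendieckGroup ((Monogenic.Φc d.fieldFunctor (d.relEmb.isConstantSection hq)).obj (op X))
      from d.liftPair hq X z) ∈ Monogenic.BSub d.fieldFunctor (d.relEmb.isConstantSection hq) (op X) := by
  refine (Monogenic.mem_BSub_iff _ _ _ _).mpr ?_
  -- the two sides of the fibre-product condition as homomorphisms into the concrete group `(Φ₀(X))^gp`
  let f₁ : Algebra.GrothendieckGroup ↥((d.dashCoveringMonoid q).invariants (X.sg : Subgroup d.Gal)) →*
      Algebra.GrothendieckGroup (Realification (OrdInt (d.fieldFunctor.obj X).K)) :=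
    ((divZeroOn d.fieldFunctor).app (op X)).hom.comp ((MonoidHom.fst _ _).comp (d.liftPair hq X))
  let f₂ : Algebra.GrothendieckGroup ↥((d.dashCoveringMonoid q).invariants (X.sg : Subgroup d.Gal)) →*
      Algebra.GrothendieckGroup (Realification (OrdInt (d.fieldFunctor.obj X).K)) :=
    ((Functor.whiskerRight (Monogenic.ιc d.fieldFunctor (d.relEmb.isConstantSection hq)) MonGp.functor).app
        (op X)).hom.comp ((MonoidHom.snd _ _).comp (d.liftPair hq X))
  have key : f₁ = f₂ := by
    refine MonGp.hom_ext fun x => ?_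
    change ((divZeroOn d.fieldFunctor).app (op X)).hom (d.liftPair hq X (Algebra.GrothendieckGroup.of x)).1 =
      ((Functor.whiskerRight (Monogenic.ιc d.fieldFunctor (d.relEmb.isConstantSection hq)) MonGp.functor).app
        (op X)).hom (d.liftPair hq X (Algebra.GrothendieckGroup.of x)).2
    rw [liftPair_of]
    exact (Monogenic.mem_BSub_iff _ _ _ _).mp (d.pairHom_mem_BSub hq X x)
  exact DFunLike.congr_fun key z

/-- **`β(G/V) : (M^V)^gp →* B^c(G/V)`** — the groupified extension of `pairHom`. [cite: MochizukiFrdII2008, Ex 1.1 (ii) p.8] -/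
def betaApp (X : CosetCat d.Gal) :
    Algebra.GrothendieckGroup ↥((d.dashCoveringMonoid q).invariants (X.sg : Subgroup d.Gal)) →*
      ↥(Monogenic.BSub d.fieldFunctor (d.relEmb.isConstantSection hq) (op X)) where
  toFun z := ⟨d.liftPair hq X z, d.liftPair_mem_BSub hq X z⟩
  map_one' := Subtype.ext (map_one (d.liftPair hq X))
  map_mul' a b := Subtype.ext (map_mul (d.liftPair hq X) a b)

/-- `β(G/V)` on generators: `[x] ↦ pairHom x`. [cite: MochizukiFrdII2008, Ex 1.1 (ii) p.8] -/
theorem betaApp_of (X : CosetCat d.Gal) (x : (d.dashCoveringMonoid q).invariants (X.sg : Subgroup d.Gal)) :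
    Subtype.val (d.betaApp hq X (Algebra.GrothendieckGroup.of x)) = d.pairHom hq X x :=
  d.liftPair_of hq X x

/-! ### Naturality of `β` and the `DataHom` -/

/-- The `B₀`-coordinate is natural: along `f : G/U → G/V` (point `g·V`) (A)'s `pull f` acts by a representative `g`, and
the field functor's `Ω^V → Ω^U` is `x ↦ g·x`. [cite: Mochizuki2012, II Def 3.8 (i) p.113] -/
theorem bZeroHom_pull {X Y : CosetCat d.Gal} (f : X ⟶ Y)
    (y : (d.dashCoveringMonoid q).invariants (Y.sg : Subgroup d.Gal)) :
    d.bZeroHom X ((d.dashCoveringMonoid q).pull f y) =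
      Units.map ((d.fieldFunctor.map f).alg : (d.fieldFunctor.obj Y).K →* (d.fieldFunctor.obj X).K) (d.bZeroHom Y y) := by
  obtain ⟨g, hg⟩ := Quotient.exists_rep (CosetCat.pt f)
  apply Units.ext
  apply Subtype.ext
  have hL : Subtype.val ((d.bZeroHom X ((d.dashCoveringMonoid q).pull f y) : ((d.fieldFunctor.obj X).K)ˣ) : (d.fieldFunctor.obj X).K)
      = g ((((d.ofO y.1 : d.dashCovering q) : intNonzero d.Ω) : d.Ω)) := by
    change (((d.ofO ((d.dashCoveringMonoid q).pull f y).1 : d.dashCovering q) : intNonzero d.Ω) : d.Ω) = _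
    have h := congrArg d.ofO ((d.dashCoveringMonoid q).coe_pull_eq_act f hg y)
    rw [h, ofO_act]
    rfl
  have hR : Subtype.val ((Units.map ((d.fieldFunctor.map f).alg : (d.fieldFunctor.obj Y).K →* (d.fieldFunctor.obj X).K)
      (d.bZeroHom Y y) : ((d.fieldFunctor.obj X).K)ˣ) : (d.fieldFunctor.obj X).K)
      = g ((((d.ofO y.1 : d.dashCovering q) : intNonzero d.Ω) : d.Ω)) :=
    d.fixedHom_apply_coe f g hg.symm _
  exact hL.trans hR.symm

end GaloisValDatum

end Literature.IUT.HodgeTheaters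

end
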